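import Summits.QuantumFields.YangMills.Theorems.UnitScaleTiltProp8ChartOneStep
import Summits.QuantumFields.YangMills.Theorems.UnitScaleTiltProp8ChartCovariance
import Literature.Analysis.Calculus.ExpLocalLieSubalgebra
import HarnessLib

/-!
# Route `UnitScaleTilt`, crux K1 «MinimiserStabilityRegPr» (stmt-QuantumFields-19200), leaf V2′ `stub_halvingStep` — pillar P3 `ChartPerLevel`:
# **k-UNIFORM NEAR-FLATNESS OF THE ITERATED UNGUARDED (0.4) AVERAGE, FACTORISED** ([Balaban1985Averaging] Prop. 4's smallness, the nonlinear twin of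
# `Q^{(k)} = L^k·Q_k − dΛ_k`)

Cell `ym3-torus` ∕ fleet seat `ym-ust-19200-p2` g6 (v8 PEN).  THE ENGINE behind the hCd/hCq letters of the P3 text `ChartRemainderAt` (p539223): on the
weighted sup-ball the charted field `e^{iηA}` is within `s₀ ≍ R·L^{1−j}` of `1` on the fine bonds read by a level-`j` index (p546323
`weighted_read_bound`), and one needs the iterated averages `Ū^{(i)}`, `i ≤ j`, to stay within `O(L^i s₀) = O(R)` of `1` UNIFORMLY IN `i` — but the sup norm
propagated naively through the true (0.4) average loses a factor `1 + d` per level (comb terms).  Here the propagation is done in FACTORISED form: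
**`exists_factorisation_emlIterU`** — for every level `i ≤ m + K`, every set `S` of `i`-sites and every `𝔸ˣ`-field `U` with `‖U(b) − 1‖ ≤ s₀` on the fine
bonds under `S` (`Bⁱ(b₋), Bⁱ(b₊) ∈ S`) and `6400·ℓ²·Lⁱ·s₀ ≤ 1` (`ℓ = (d+2)L`), there is a coarse gauge `H : S → 𝔸ˣ` with
`‖H(y) − 1‖ ≤ 8ℓ·Lⁱ·s₀` on `S` and `‖H(e₋)⁻¹·Ū^{(i)}(e)·H(e₊) − 1‖ ≤ Lⁱs₀·(1 + 6400ℓ²Lⁱs₀) ≤ 2·Lⁱ·s₀` on the `i`-bonds with both ends in `S`: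
the straight part grows by EXACTLY `L` per level to first order (p548268/`…OneStep` `norm_conj_emlAvgU_sub_one_le`), the comb means are absorbed into `H` by
covariance (p547331 `emlAvgU_gaugeActT`), and the second-order corrections are summable.  Corollary **`norm_emlIterU_sub_one_le_of_reads`**:
`‖Ū^{(i)}(e) − 1‖ ≤ 30ℓ·Lⁱ·s₀` there.  Sorry-free, definition-free (the gauge is produced inside the induction; `exp(±a)` inverses from `Literature.Analysis.Calculus`).  NOT a claim about the mass gap.

References: T. Bałaban, CMP **98** (1985) 17–51 [Balaban1985Averaging] (Prop. 3 (122)–(125) p.36, Prop. 4 (134)–(135) p.38, (62)–(63) p.28); CMP **109** (1987)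
249–301 [Balaban1987RG1] ((0.4), (0.11), (0.21) pp.253–256); CMP **102** (1985) 277–309 [Balaban1985Variational] ((44)–(48) p.285, (152) p.301).
-/

noncomputable section

open scoped BigOperators
open NormedSpace

namespace Summit.QuantumFields.YangMills.Theorems.Prop8Chart

open Literature.MathematicalPhysics.QuantumFieldTheory.Balaban1983to89
open T4Continuum BlockAveraging AveragingRT ExpMeanLog MatrixLog BlockAveragingEMLLinearised
open B10Eq27TorusAxialLog (holT gaugeActT gaugeActT_apply)
open B5Eq118OneStroke (iterBlockOf iterBlockOf_succ iterBlockOf_zero)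

variable {P : Params}
variable {𝔸 : Type*} [NormedRing 𝔸] [NormedAlgebra ℂ 𝔸] [CompleteSpace 𝔸] [NormOneClass 𝔸]

/-! ## §1 Small algebra: exponential units, gauge composition -/

omit [NormOneClass 𝔸] in
/-- `exp(a)` as a unit with inverse `exp(−a)` (coercions by `rfl`). [folklore] -/
theorem val_inv_expUnit (a : 𝔸) :
    (((⟨exp a, exp (-a), Literature.Analysis.Calculus.exp_mul_exp_neg a, Literature.Analysis.Calculus.exp_neg_mul_exp a⟩ : 𝔸ˣ)⁻¹ : 𝔸ˣ) : 𝔸) =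
      exp (-a) := rfl

omit [NormedAlgebra ℂ 𝔸] [CompleteSpace 𝔸] [NormOneClass 𝔸] in
/-- Undoing a gauge transformation: `(V^{u⁻¹})^{u} = V`. [cite: Balaban1985Averaging, (8) p.19] -/
theorem gaugeActT_gaugeActT_inv {j : ℕ} (u : GaugeTransf P j 𝔸ˣ) (V : GaugeField P j 𝔸ˣ) :
    gaugeActT u (gaugeActT (fun y => (u y)⁻¹) V) = V := by
  funext e
  simp only [gaugeActT_apply, inv_inv]
  group

omit [NormedAlgebra ℂ 𝔸] [CompleteSpace 𝔸] [NormOneClass 𝔸] in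
/-- Three near-`1` factors: `‖xyz − 1‖ ≤ (1+a)(1+b)(1+c) − 1`. [folklore] -/
theorem norm_mul_three_sub_one_le {x y z : 𝔸} {a b c : ℝ} (hx : ‖x - 1‖ ≤ a) (hy : ‖y - 1‖ ≤ b) (hz : ‖z - 1‖ ≤ c) :
    ‖x * y * z - 1‖ ≤ (1 + a) * (1 + b) * (1 + c) - 1 := by
  have ha : 0 ≤ a := (norm_nonneg _).trans hx
  have hb : 0 ≤ b := (norm_nonneg _).trans hy
  have hc : 0 ≤ c := (norm_nonneg _).trans hz
  have e : x * y * z - 1 = (x - 1) * (y - 1) * (z - 1) + (x - 1) * (y - 1) + (x - 1) * (z - 1) + (y - 1) * (z - 1) +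
      (x - 1) + (y - 1) + (z - 1) := by noncomm_ring
  rw [e]
  have h3 : ‖(x - 1) * (y - 1) * (z - 1)‖ ≤ a * b * c :=
    (norm_mul_le _ _).trans (mul_le_mul ((norm_mul_le _ _).trans (mul_le_mul hx hy (norm_nonneg _) ha)) hz (norm_nonneg _) (by positivity))
  have hxy : ‖(x - 1) * (y - 1)‖ ≤ a * b := (norm_mul_le _ _).trans (mul_le_mul hx hy (norm_nonneg _) ha)
  have hxz : ‖(x - 1) * (z - 1)‖ ≤ a * c := (norm_mul_le _ _).trans (mul_le_mul hx hz (norm_nonneg _) ha)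
  have hyz : ‖(y - 1) * (z - 1)‖ ≤ b * c := (norm_mul_le _ _).trans (mul_le_mul hy hz (norm_nonneg _) hb)
  calc _ ≤ ‖(x - 1) * (y - 1) * (z - 1)‖ + ‖(x - 1) * (y - 1)‖ + ‖(x - 1) * (z - 1)‖ + ‖(y - 1) * (z - 1)‖ +
        ‖x - 1‖ + ‖y - 1‖ + ‖z - 1‖ := by
          refine (norm_add_le _ _).trans (add_le_add ?_ le_rfl)
          refine (norm_add_le _ _).trans (add_le_add ?_ le_rfl)
          refine (norm_add_le _ _).trans (add_le_add ?_ le_rfl)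
          refine (norm_add_le _ _).trans (add_le_add ?_ le_rfl)
          refine (norm_add_le _ _).trans (add_le_add ?_ le_rfl)
          exact (norm_add_le _ _).trans (add_le_add le_rfl le_rfl)
    _ ≤ a * b * c + a * b + a * c + b * c + a + b + c := by gcongr
    _ = (1 + a) * (1 + b) * (1 + c) - 1 := by ring

/-! ## §2 The factorised propagation through the levels -/

/-- The numeric step of the propagation: `L·σ + 800ℓ²σ² ≤ L^{i+1}s₀(1 + 6400ℓ²L^{i+1}s₀)` for `σ = Lⁱs₀(1 + 6400ℓ²Lⁱs₀) ≤ 2Lⁱs₀`, `L ≥ 2`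
(`L² ≥ L + ½`). [folklore] -/
theorem step_budget {L ℓ x s : ℝ} (hL : 2 ≤ L) (hσ : s = x * (1 + 6400 * ℓ ^ 2 * x)) (hσ2 : s ≤ 2 * x) (hs0 : 0 ≤ s) :
    L * s + 800 * ℓ ^ 2 * s ^ 2 ≤ L * x * (1 + 6400 * ℓ ^ 2 * (L * x)) := by
  have hss : s ^ 2 ≤ (2 * x) ^ 2 := pow_le_pow_left₀ hs0 hσ2 2
  have h1 : 800 * ℓ ^ 2 * s ^ 2 ≤ 3200 * ℓ ^ 2 * x ^ 2 := by nlinarith [mul_le_mul_of_nonneg_left hss (sq_nonneg ℓ)]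
  have h2 : L * s = L * x + 6400 * ℓ ^ 2 * L * x ^ 2 := by rw [hσ]; ring
  have hL2 : L + 1 / 2 ≤ L ^ 2 := by nlinarith
  nlinarith [mul_nonneg (mul_nonneg (sq_nonneg ℓ) (sq_nonneg x)) (sub_nonneg.2 hL2)]

/-- **k-UNIFORM NEAR-FLATNESS OF THE ITERATED UNGUARDED (0.4) AVERAGE, IN FACTORISED FORM.**  Let `ℓ = (d+2)L`.  For every level `i ≤ m + K`, every set `S` of
`i`-sites, every `𝔸ˣ`-field `U` on the finest lattice with `‖U(b) − 1‖ ≤ s₀` on the bonds `b` with `Bⁱ(b₋), Bⁱ(b₊) ∈ S`, and `6400·ℓ²·Lⁱ·s₀ ≤ 1`, there is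
a coarse gauge `H : T^{(i)} → 𝔸ˣ` with `‖H(y) − 1‖ ≤ 8ℓ·Lⁱ·s₀` for `y ∈ S` and `‖H(e₋)⁻¹·Ū^{(i)}(e)·H(e₊) − 1‖ ≤ Lⁱs₀·(1 + 6400ℓ²Lⁱs₀)` for every `i`-bond `e` with
both ends in `S` (induction over the levels: `…OneStep` one step, `…Covariance`; `S ↦ B⁻¹S`).
[cite: Balaban1985Averaging, Prop. 4 (134)-(135) p.38, Prop. 3 (122)-(125) p.36; Balaban1987RG1, (0.21) p.256] -/
theorem exists_factorisation_emlIterU :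
    ∀ (i : ℕ), i ≤ P.m + P.K → ∀ (S : Set (Site P i)) (U : GaugeField P 0 𝔸ˣ) (s₀ : ℝ), 0 ≤ s₀ →
      6400 * (((P.d + 2) * P.L : ℕ) : ℝ) ^ 2 * (P.L : ℝ) ^ i * s₀ ≤ 1 →
      (∀ b : PBond P 0, iterBlockOf i b.src ∈ S → iterBlockOf i b.tgt ∈ S → ‖((U b : 𝔸ˣ) : 𝔸) - 1‖ ≤ s₀) →
      ∃ H : Site P i → 𝔸ˣ,
        (∀ y ∈ S, ‖((H y : 𝔸ˣ) : 𝔸) - 1‖ ≤ 8 * (((P.d + 2) * P.L : ℕ) : ℝ) * (P.L : ℝ) ^ i * s₀) ∧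
        ∀ e : PBond P i, e.src ∈ S → e.tgt ∈ S →
          ‖(((H e.src)⁻¹ : 𝔸ˣ) : 𝔸) * ((emlIterU i U e : 𝔸ˣ) : 𝔸) * ((H e.tgt : 𝔸ˣ) : 𝔸) - 1‖ ≤
            (P.L : ℝ) ^ i * s₀ * (1 + 6400 * (((P.d + 2) * P.L : ℕ) : ℝ) ^ 2 * ((P.L : ℝ) ^ i * s₀)) := by
  set ℓ : ℝ := (((P.d + 2) * P.L : ℕ) : ℝ) with hℓ
  have hℓ1 : (1 : ℝ) ≤ ℓ := by
    rw [hℓ]; exact_mod_cast Nat.one_le_iff_ne_zero.mpr (Nat.mul_ne_zero (by omega) (by have := P.hL.2; omega))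
  have hℓ0 : (0 : ℝ) ≤ ℓ := by linarith
  have hL2 : (2 : ℝ) ≤ P.L := by exact_mod_cast P.hL.2
  have hL0 : (0 : ℝ) ≤ P.L := by linarith
  intro i
  induction i with
  | zero =>
    intro _ S U s₀ hs₀ _ hU
    refine ⟨fun _ => 1, fun y _ => ?_, fun e hs ht => ?_⟩
    · simp only [Units.val_one, sub_self, norm_zero, pow_zero, mul_one]
      exact mul_nonneg (mul_nonneg (by norm_num) hℓ0) hs₀
    have h := hU e (by simpa using hs) (by simpa using ht)
    simp only [inv_one, Units.val_one, one_mul, mul_one, emlIterU_zero, pow_zero]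
    have hB : 0 ≤ 6400 * ℓ ^ 2 * (1 * s₀) := by positivity
    nlinarith
  | succ i ih =>
    intro hi S U s₀ hs₀ hbudget hU
    -- letters
    set x : ℝ := (P.L : ℝ) ^ i * s₀ with hx
    have hx0 : 0 ≤ x := by positivity
    have hpow : (P.L : ℝ) ^ (i + 1) * s₀ = P.L * x := by rw [hx, pow_succ]; ring
    have hbudget' : 6400 * ℓ ^ 2 * ((P.L : ℝ) * x) ≤ 1 := by
      have : 6400 * ℓ ^ 2 * (P.L : ℝ) ^ (i + 1) * s₀ = 6400 * ℓ ^ 2 * ((P.L : ℝ) * x) := by rw [hx, pow_succ]; ring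
      rwa [this] at hbudget
    have hbudget_i : 6400 * ℓ ^ 2 * (P.L : ℝ) ^ i * s₀ ≤ 1 := by
      have h1 : 6400 * ℓ ^ 2 * x ≤ 6400 * ℓ ^ 2 * ((P.L : ℝ) * x) := by
        have : x ≤ P.L * x := by nlinarith
        exact mul_le_mul_of_nonneg_left this (by positivity)
      rw [hx] at h1; linarith
    have hxsmall : 6400 * ℓ ^ 2 * x ≤ 1 := by rw [hx]; linarith [hbudget_i]
    -- the induction hypothesis one level down, on `B⁻¹ S`
    set S' : Set (Site P i) := {y | blockOf y ∈ S} with hS'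
    have hU' : ∀ b : PBond P 0, iterBlockOf i b.src ∈ S' → iterBlockOf i b.tgt ∈ S' → ‖((U b : 𝔸ˣ) : 𝔸) - 1‖ ≤ s₀ :=
      fun b hs ht => hU b (by rw [iterBlockOf_succ]; exact hs) (by rw [iterBlockOf_succ]; exact ht)
    obtain ⟨H, hH1, hHS⟩ := ih (Nat.le_of_succ_le hi) S' U s₀ hs₀ hbudget_i hU'
    -- the straight part at level `i` and its size `σ`
    set σ : ℝ := x * (1 + 6400 * ℓ ^ 2 * x) with hσ
    have hσ0 : 0 ≤ σ := by positivity
    have hσ2 : σ ≤ 2 * x := by rw [hσ]; nlinarith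
    have h48 : 48 * ℓ * σ ≤ 1 := by
      have h1 : 48 * ℓ * σ ≤ 96 * ℓ * x := by nlinarith [mul_nonneg hℓ0 hx0]
      have h2 : 96 * ℓ * x ≤ 6400 * ℓ ^ 2 * x := by nlinarith [mul_nonneg hℓ0 hx0]
      linarith
    have hℓσ : ℓ * σ ≤ 1 / 48 := by nlinarith [mul_nonneg hℓ0 hσ0]
    set Sfld : GaugeField P i 𝔸ˣ := gaugeActT (fun y => (H y)⁻¹) (emlIterU i U) with hSfld
    have hfac : emlIterU i U = gaugeActT H Sfld := (gaugeActT_gaugeActT_inv H _).symm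
    have hSfld_apply : ∀ e : PBond P i, ((Sfld e : 𝔸ˣ) : 𝔸) = (((H e.src)⁻¹ : 𝔸ˣ) : 𝔸) * ((emlIterU i U e : 𝔸ˣ) : 𝔸) * ((H e.tgt : 𝔸ˣ) : 𝔸) := by
      intro e; rw [hSfld, gaugeActT_apply, inv_inv, Units.val_mul, Units.val_mul]
    have hSσ : ∀ e : PBond P i, e.src ∈ S' → e.tgt ∈ S' → ‖((Sfld e : 𝔸ˣ) : 𝔸) - 1‖ ≤ σ := by
      intro e hs ht; rw [hSfld_apply]; exact hHS e hs ht
    -- the averaged field is the covariantly transformed average of the straight part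
    have hnext : emlIterU (i + 1) U = gaugeActT (fun y : Site P (i + 1) => H (emb y)) (emlAvgU Sfld) := by
      rw [emlIterU_succ, hfac, emlAvgU_gaugeActT]
    -- the comb means of the straight part, block by block, and the new gauge
    set lam : Site P (i + 1) → 𝔸 := fun y => ((Fintype.card (Idx P) : ℂ))⁻¹ • ∑ idx : Idx P,
      walkSum (fun b => ((Sfld b : 𝔸ˣ) : 𝔸) - 1) (walk (emb y) (stairWord idx.2.1 (off idx.1))) with hlam
    let g : Site P (i + 1) → 𝔸ˣ := fun y =>
      ⟨exp (lam y), exp (-(lam y)), Literature.Analysis.Calculus.exp_mul_exp_neg _, Literature.Analysis.Calculus.exp_neg_mul_exp _⟩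
    have hg_val : ∀ y, ((g y : 𝔸ˣ) : 𝔸) = exp (lam y) := fun y => rfl
    have hg_inv : ∀ y, (((g y)⁻¹ : 𝔸ˣ) : 𝔸) = exp (-(lam y)) := fun y => rfl
    have hlam_le : ∀ y ∈ S, ‖lam y‖ ≤ ℓ * σ := by
      intro y hy
      exact norm_combSum_mean_le_of_block hi y hσ0 (fun b h1 h2 => hSσ b (by show blockOf b.src ∈ S; rw [h1]; exact hy)
        (by show blockOf b.tgt ∈ S; rw [h2]; exact hy))
    refine ⟨fun y => H (emb y) * g y, fun y hy => ?_, fun c hcs hct => ?_⟩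
    · -- the size of the new gauge `H(emb y)·exp(λ̄(y))`
      have hemb : emb y ∈ S' := by show blockOf (emb y) ∈ S; rw [Site.blockOf_emb hi]; exact hy
      have hHy : ‖((H (emb y) : 𝔸ˣ) : 𝔸) - 1‖ ≤ 8 * ℓ * x := by have := hH1 (emb y) hemb; rw [hx]; linarith
      have hlam1 : ‖lam y‖ ≤ 1 := (hlam_le y hy).trans (by linarith)
      have hgy : ‖((g y : 𝔸ˣ) : 𝔸) - 1‖ ≤ 2 * (ℓ * σ) := by
        rw [hg_val]; exact (B7TransferAnalyticMean.norm_exp_sub_one_le_two_mul hlam1).trans (by linarith [hlam_le y hy])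
      rw [Units.val_mul]
      have e : ((H (emb y) : 𝔸ˣ) : 𝔸) * ((g y : 𝔸ˣ) : 𝔸) - 1 =
          (((H (emb y) : 𝔸ˣ) : 𝔸) - 1) * (((g y : 𝔸ˣ) : 𝔸) - 1) + (((H (emb y) : 𝔸ˣ) : 𝔸) - 1) + (((g y : 𝔸ˣ) : 𝔸) - 1) := by
        noncomm_ring
      rw [e]
      have h8 : 0 ≤ 8 * ℓ * x := by positivity
      calc _ ≤ ‖((H (emb y) : 𝔸ˣ) : 𝔸) - 1‖ * ‖((g y : 𝔸ˣ) : 𝔸) - 1‖ + ‖((H (emb y) : 𝔸ˣ) : 𝔸) - 1‖ + ‖((g y : 𝔸ˣ) : 𝔸) - 1‖ :=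
            (norm_add_le _ _).trans (add_le_add ((norm_add_le _ _).trans (add_le_add (norm_mul_le _ _) le_rfl)) le_rfl)
        _ ≤ (8 * ℓ * x) * (2 * (ℓ * σ)) + 8 * ℓ * x + 2 * (ℓ * σ) := by gcongr
        _ ≤ (8 * ℓ * x) * (2 * (1 / 48)) + 8 * ℓ * x + 2 * (ℓ * (2 * x)) := by gcongr
        _ ≤ 8 * ℓ * ((P.L : ℝ) * x) := by nlinarith [mul_nonneg hℓ0 hx0]
        _ = 8 * ℓ * (P.L : ℝ) ^ (i + 1) * s₀ := by rw [hx, pow_succ]; ring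
    · -- the straight part one level up
      have hSc : ∀ b : PBond P i, (blockOf b.src = c.src ∨ blockOf b.src = c.tgt) → (blockOf b.tgt = c.src ∨ blockOf b.tgt = c.tgt) →
          ‖((Sfld b : 𝔸ˣ) : 𝔸) - 1‖ ≤ σ := by
        intro b hbs hbt
        refine hSσ b ?_ ?_
        · show blockOf b.src ∈ S
          rcases hbs with h | h <;> rw [h]
          exacts [hcs, hct]
        · show blockOf b.tgt ∈ S
          rcases hbt with h | h <;> rw [h]
          exacts [hcs, hct]
      obtain ⟨hstep, -, -⟩ := norm_conj_emlAvgU_sub_one_le hi c hσ0 (by rw [hℓ] at h48; exact h48) hSc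
      -- the conjugated quantity IS the one of the one-step theorem
      have key : (H (emb c.src) * g c.src)⁻¹ * emlIterU (i + 1) U c * (H (emb c.tgt) * g c.tgt) = (g c.src)⁻¹ * emlAvgU Sfld c * g c.tgt := by
        rw [hnext, gaugeActT_apply]; group
      have hval : (((H (emb c.src) * g c.src)⁻¹ : 𝔸ˣ) : 𝔸) * ((emlIterU (i + 1) U c : 𝔸ˣ) : 𝔸) * ((H (emb c.tgt) * g c.tgt : 𝔸ˣ) : 𝔸) =
          exp (-(lam c.src)) * ((emlAvgU Sfld c : 𝔸ˣ) : 𝔸) * exp (lam c.tgt) := by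
        rw [← Units.val_mul, ← Units.val_mul, key, Units.val_mul, Units.val_mul, hg_inv, hg_val]
      rw [hval, hpow]
      refine hstep.trans ?_
      rw [← hℓ]
      exact step_budget hL2 hσ hσ2 hσ0

/-- **COROLLARY: THE ITERATED AVERAGES STAY NEAR `1`, UNIFORMLY IN THE LEVEL** — `‖Ū^{(i)}(e) − 1‖ ≤ 30ℓ·Lⁱ·s₀` on the `i`-bonds with both ends in `S`
(from `Ū^{(i)}(e) = H(e₋)·[H(e₋)⁻¹Ū^{(i)}(e)H(e₊)]·H(e₊)⁻¹`). [cite: Balaban1985Averaging, Prop. 4 (134)-(135) p.38] -/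
theorem norm_emlIterU_sub_one_le_of_reads {i : ℕ} (hi : i ≤ P.m + P.K) (S : Set (Site P i)) (U : GaugeField P 0 𝔸ˣ) {s₀ : ℝ} (hs₀ : 0 ≤ s₀)
    (hbudget : 6400 * (((P.d + 2) * P.L : ℕ) : ℝ) ^ 2 * (P.L : ℝ) ^ i * s₀ ≤ 1)
    (hU : ∀ b : PBond P 0, iterBlockOf i b.src ∈ S → iterBlockOf i b.tgt ∈ S → ‖((U b : 𝔸ˣ) : 𝔸) - 1‖ ≤ s₀)
    (e : PBond P i) (hs : e.src ∈ S) (ht : e.tgt ∈ S) :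
    ‖((emlIterU i U e : 𝔸ˣ) : 𝔸) - 1‖ ≤ 30 * (((P.d + 2) * P.L : ℕ) : ℝ) * (P.L : ℝ) ^ i * s₀ := by
  set ℓ : ℝ := (((P.d + 2) * P.L : ℕ) : ℝ) with hℓ
  have hℓ1 : (1 : ℝ) ≤ ℓ := by
    rw [hℓ]; exact_mod_cast Nat.one_le_iff_ne_zero.mpr (Nat.mul_ne_zero (by omega) (by have := P.hL.2; omega))
  have hℓ0 : (0 : ℝ) ≤ ℓ := by linarith
  set x : ℝ := (P.L : ℝ) ^ i * s₀ with hx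
  have hx0 : 0 ≤ x := by positivity
  have hxsmall : 6400 * ℓ ^ 2 * x ≤ 1 := by rw [hx]; linarith [hbudget]
  obtain ⟨H, hH1, hHS⟩ := exists_factorisation_emlIterU i hi S U s₀ hs₀ hbudget hU
  have hHs : ‖((H e.src : 𝔸ˣ) : 𝔸) - 1‖ ≤ 8 * ℓ * x := by have := hH1 e.src hs; rw [hx]; linarith
  have hHt : ‖((H e.tgt : 𝔸ˣ) : 𝔸) - 1‖ ≤ 8 * ℓ * x := by have := hH1 e.tgt ht; rw [hx]; linarith
  have h8 : 8 * ℓ * x ≤ 1 / 2 := by nlinarith [mul_nonneg hℓ0 hx0]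
  have hHt' : ‖(((H e.tgt)⁻¹ : 𝔸ˣ) : 𝔸) - 1‖ ≤ 2 * (8 * ℓ * x) := norm_inv_sub_one_le_two_mul hHt h8
  have hmid : ‖(((H e.src)⁻¹ : 𝔸ˣ) : 𝔸) * ((emlIterU i U e : 𝔸ˣ) : 𝔸) * ((H e.tgt : 𝔸ˣ) : 𝔸) - 1‖ ≤ 2 * x := by
    refine (hHS e hs ht).trans ?_
    rw [← hx]; nlinarith
  have hid : ((emlIterU i U e : 𝔸ˣ) : 𝔸) =
      ((H e.src : 𝔸ˣ) : 𝔸) * ((((H e.src)⁻¹ : 𝔸ˣ) : 𝔸) * ((emlIterU i U e : 𝔸ˣ) : 𝔸) * ((H e.tgt : 𝔸ˣ) : 𝔸)) * (((H e.tgt)⁻¹ : 𝔸ˣ) : 𝔸) := by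
    rw [← Units.val_mul, ← Units.val_mul, ← Units.val_mul, ← Units.val_mul]
    congr 1; group
  rw [hid]
  refine (norm_mul_three_sub_one_le hHs hmid hHt').trans ?_
  rw [hx]
  nlinarith [mul_nonneg hℓ0 hx0, mul_nonneg (mul_nonneg hℓ0 hx0) hx0, mul_nonneg (mul_nonneg hℓ0 hℓ0) (mul_nonneg hx0 hx0),
    mul_nonneg (mul_nonneg (mul_nonneg hℓ0 hℓ0) (mul_nonneg hx0 hx0)) hx0, sq_nonneg x]

end Summit.QuantumFields.YangMills.Theorems.Prop8Chart

end
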